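import Literature.AlgebraicGeometry.HodgeTheory.BettiHodgeConjectureProductsOffMiddleAlgebraicFactor
import Literature.AlgebraicGeometry.HodgeTheory.BettiHodgeConjectureSurfaceSquareGenericEndomorphisms
import Literature.AlgebraicGeometry.HodgeTheory.BettiHodgeConjectureProductNoExceptionalClasses
import Literature.AlgebraicGeometry.HodgeTheory.BettiHodgeConjectureRankForm
import HarnessLib

/-!
# `HC(X × X)` for `X` of EVEN dimension `n = 2h` with algebraic off-middle cohomology and `dim End_HS(HⁿX) ≤ ρ_h(X)² + 1`, `ρ_h = dim_ℚ Hdgʰ(HⁿX)`: the middle Künneth component of the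
# diagonal lies outside `Hdgʰ ⊗ Hdgʰ` and, with it, exhausts the Hodge classes of `Hⁿ(X) ⊗ Hⁿ(X)`
# (Voisin I §11.3.3 Thm. 11.38–11.40, Lemma 11.41, p. 287; Voisin 2025 §3.2.1; Voisin II proof of Thm. 10.17)

Family `hodge`, lane `lit-hodgefound` (Track 2 foundations library; Layers A1/A4), layer `Literature/AlgebraicGeometry/HodgeTheory`.  THEOREMS ONLY (no definition, no named fact, no instance;
D-0026 net debt `0`).  The seat's g29-#4 (`BettiHodgeConjectureSurfaceSquareGenericEndomorphisms`) proved `HC(S × S)` for every surface with `dim End_HS(H²S) ≤ ρ(S)² + 1`, and g29-#6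
(`BettiHodgeConjectureSquareOffMiddleAlgebraic`) proved `HC(X × X)` for `X` OFF-MIDDLE ALGEBRAIC (`Hᵏ(X;ℚ) = 0` for odd `k ≠ n`, `Hdgᵖ(H^{2p}X) = H^{2p}(X;ℚ)` for `2p ≠ n`) with `HC(X)` and
`dim End_HS(HⁿX) ≤ 1` — the right bound for ODD `n`.  For EVEN `n = 2h` the middle cohomology contains the Hodge classes `Hdgʰ(HⁿX) ∋ η^h`, so `End_HS(HⁿX) ⊇ End(Hdgʰ) ⊕ End_HS(T)` has dimension
`≥ ρ_h² + 1` (`T` the transcendental part), and the right hypothesis is the one of g29-#4: **`dim End_HS(HⁿX) ≤ ρ_h² + 1`**, i.e. `End_HS(T) = ℚ` and no morphism between `T` and `Hdgʰ ⊗ ℚ(−h)`.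
This file proves that generalisation.

WHAT IS PROVED.
* §1 **`BettiUniverse.not_mem_range_mapIncl_of_corrAction_eq_id`** (any `n`, no hypothesis on `X`): a class `t ∈ Hⁿ(X) ⊗ Hⁿ(X)` whose cross product acts as the IDENTITY on `Hⁿ(X;ℂ)` does not lie in
  `N ⊗ N'` for any PROPER `ℚ`-subspace `N ⊊ Hⁿ(X;ℚ)` and any `N'` — such a correspondence maps `Hⁿ(X;ℂ)` into `span_ℂ(N ⊗ 1)` (g29-#4 §1, the projection formula), of dimension `dim_ℚ N < b_n`
  (`finrank_span_image_ofRatClass`).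
* §2 **`BettiUniverse.hodgeConjectureFor_tensor_self_of_offMiddle_algebraic_of_finrank_end_le`**: for `X` smooth projective of even dimension `n = 2h` with `HC(X)`, no odd cohomology,
  `Hdgᵖ(H^{2p}X) = H^{2p}(X;ℚ)` for `2p ≠ n` and `dim_ℚ End_HS(HⁿX) ≤ ρ_h² + 1`, `HC(X × X)` holds for every smooth-projective structure on `X × X`.  Proof: by g29-#2 only the pieces
  `Hⁱ ⊗ Hʲ`, `1 ≤ i, j ≤ n`, matter; those other than `Hⁿ ⊗ Hⁿ` are zero or have a pure factor (g29-#6 §1); if `Hdgʰ(HⁿX) = Hⁿ(X;ℚ)` every even degree is pure and g27-#5 applies; otherwise the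
  middle Künneth component `t_{n,n}` of `[Δ_X]` (g29-#6 §2: a Hodge class with algebraic cross product acting as `Id` on `Hⁿ(X;ℂ)`) lies outside `Hdgʰ ⊗ Hdgʰ` (§1), so
  `Hdgʰ ⊗ Hdgʰ ⊕ ℚ·t_{n,n}` has dimension `ρ_h² + 1 ≥ dim Hdgⁿ(Hⁿ ⊗ Hⁿ) = dim End_HS(HⁿX)` (Lemma 11.41) and exhausts the Hodge classes of the middle piece, all with algebraic cross products
  (`Hdgʰ ⊗ Hdgʰ`: exterior products of algebraic classes, by `HC(X)`).
* §3 **`IsSmoothHypersurface.hodgeConjectureFor_tensor_self_of_even_of_finrank_end_le`**: `HC(Y × Y)` for a smooth hypersurface `Y ⊂ ℙ^{m+1}_ℂ` of even dimension `m = 2h` with `HC(Y)` and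
  `dim End_HS(HᵐY) ≤ ρ_h² + 1` (Voisin II Cor. 1.24/1.25 through g29-#7's `IsSmoothHypersurface.finrank_bettiCohomology_eq_zero_of_odd` / `hodgeClasses_hodge_eq_top_of_two_mul_ne`).

THE PRINTS.  C. Voisin (2002) [VoisinHodgeI2002] §11.3.3 Thm. 11.38 (Künneth; bidegrees of `pr₁^*α ∪ pr₂^*β`), Thm. 11.40 and p. 287 (Künneth components of Hodge / algebraic classes; «`Σ_k Id_k` is
equal to the cohomology class of the diagonal»), Lemma 11.41 (`Hdg(Hᵏ ⊗ Hˡ) ↔ Hom_HS`), pp. 286–287 (the action of a class of `Hᵏ(X) ⊗ Hˡ(Y)`).  C. Voisin (2003) [VoisinHodgeII2003] §9.2.4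
Prop. 9.20, §10.2.2 proof of Thm. 10.17 (10.7) (the action of a decomposable correspondence).  C. Voisin (2025) [Voisin2025] §3.2.1 (12)–(14), Prop. 3.8, Cor. 3.9 (Künneth components of the
diagonal).  C. Voisin (2003) [VoisinHodgeII2003] §1.2.3 Cor. 1.24–1.25 (cohomology of smooth hypersurfaces).  P. Deligne (2000/2006) [Deligne2000] §1.

THE OBJECTS (all the tree's).  `X : SchemeOver ℂ`, `hX : IsSmoothProjective n X`, `hXX : IsSmoothProjective d (X ⊗ X)`; `hHD : exists_isReal_hodgeModel`; `Hᵏ(X) = BettiUniverse.hodge hHD hX k`,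
`hodgeClasses`, `HodgeStructure.Hom`, `tensor`; `BettiUniverse.kunnethSummand`, `BettiUniverse.crossMap`; `corrAction complexOrientationFamily` (the action of a correspondence),
`TensorProduct.mapIncl N N'` (`N ⊗ N' ⊆ Hⁿ ⊗ Hⁿ`); `bettiCohomology`, `complexBetti`, `ofRatClass`, `algebraicClasses`, `HodgeConjectureFor`.

DEVIATIONS / SCOPE.  The bound `dim End_HS(HⁿX) ≤ ρ_h² + 1` is a hypothesis (it holds for the general member of a family with big monodromy on the transcendental part); the odd-dimensional
case is g29-#6 (`…_of_finrank_end_le_one`).  No definitions.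

## References
* [VoisinHodgeI2002] C. Voisin, *Hodge Theory and Complex Algebraic Geometry I* (2002) — §11.3.3 Thm. 11.38, Thm. 11.40, Lemma 11.41, pp. 286–287; §7.1.1.
* [VoisinHodgeII2003] C. Voisin, *Hodge Theory and Complex Algebraic Geometry II* (2003) — §1.2.3 Cor. 1.24–1.25; §9.2.4 Prop. 9.20; §10.2.2 proof of Thm. 10.17 (10.7).
* [Voisin2025] C. Voisin, *Cycle classes on algebraic varieties* (2025) — §3.2.1 (12)–(14), Prop. 3.8, Cor. 3.9.
* [Deligne2000] P. Deligne, *The Hodge conjecture* (Clay problem description) — §1.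
* [HatcherAT2002] A. Hatcher, *Algebraic Topology* (2002) — §3.1 p. 198.

## Provenance
Lane `lit-hodgefound` (Hodge path, Track 2), prover seat `lit-hodgefound-p29` (generation 29), self-proposed row g29-#8 (the even-dimensional form of g29-#4/#6).
-/

noncomputable section

open scoped TensorProduct
open CategoryTheory MonoidalCategory CartesianMonoidalCategory Module Finset
open Literature.AlgebraicTopology.SingularHomology
open Literature.Geometry.Kaehler

namespace Literature.AlgebraicGeometry.HodgeTheory

open Literature.AlgebraicGeometry.Motives
open Literature.AlgebraicGeometry.Motives.HodgeStructure

variable {n d : ℕ} {X : SchemeOver ℂ}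

/-! ### §0 Plumbing -/

/-- `(q • a) ⊗ 1 = q • (a ⊗ 1)` for the lattice map `Hᵏ(Y;ℚ) → Hᵏ(Y;ℂ)` (private copy of the tree's file-local lemma). [cite: HatcherAT2002, §3.1 p. 198] -/
private theorem ofRatClass_rat_smul' {T : Type} [TopologicalSpace T] {k : ℕ} (q : ℚ) (a : singularCohomology ℚ ℚ T k) :
    ofRatClass T k (q • a) = (q : ℂ) • ofRatClass T k a := by
  rw [ofRatClass, coeffClass_smul, smul_coeffClass]
  refine coeffClass_congr (fun x ↦ ?_) a
  simp

/-- `(y × z) ⊗ 1` is algebraic for `y ⊗ 1 ∈ Nᵃ(Y)`, `z ⊗ 1 ∈ Nᵇ(Z)`, at any total codimension `c = a + b` (the tree's `ofRatClass_crossMap_tmul_mem_algebraicClasses`, re-indexed).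
[cite: VoisinHodgeII2003, §9.2.4 proof of Prop. 9.20] -/
private theorem ofRatClass_crossMap_tmul_mem_algebraicClasses' {m' n' : ℕ} {Y Z : SchemeOver ℂ} (hY : IsSmoothProjective m' Y) (hZ : IsSmoothProjective n' Z) {a b c : ℕ}
    (hc : 2 * a + 2 * b = 2 * c) {y : bettiCohomology Y (2 * a)} {z : bettiCohomology Z (2 * b)} (hy : ofRatClass (ComplexPoints Y) (2 * a) y ∈ algebraicClasses Y a)
    (hz : ofRatClass (ComplexPoints Z) (2 * b) z ∈ algebraicClasses Z b) : ofRatClass (ComplexPoints (Y ⊗ Z)) (2 * c) (BettiUniverse.crossMap Y Z hc (y ⊗ₜ[ℚ] z)) ∈ algebraicClasses (Y ⊗ Z) c := by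
  obtain rfl : c = a + b := by omega
  exact BettiUniverse.ofRatClass_crossMap_tmul_mem_algebraicClasses hY hZ hy hz

/-! ### §1 A correspondence acting as the identity is not decomposable along a proper subspace -/

/-- **A class `t ∈ Hⁿ(X) ⊗ Hⁿ(X)` whose cross product acts as the identity on `Hⁿ(X;ℂ)` does not lie in `N ⊗ N'` for a proper `ℚ`-subspace `N ⊊ Hⁿ(X;ℚ)`**: the correspondence `crossMap t ⊗ 1`,
`t ∈ N ⊗ N'`, maps `Hⁿ(X;ℂ)` into `span_ℂ(N ⊗ 1)` (sum of rank-one actions `u ↦ ±(∫ u ∪ w) y`, pp. 286–287 / (10.7)), a subspace of dimension `dim_ℚ N < b_n(X) = dim_ℂ Hⁿ(X;ℂ)`.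
[cite: VoisinHodgeI2002, §11.3.3 pp. 286–287 and §7.1.1] [cite: VoisinHodgeII2003, §10.2.2 proof of Thm. 10.17 (10.7)] -/
theorem BettiUniverse.not_mem_range_mapIncl_of_corrAction_eq_id (hX : IsSmoothProjective n X) (N N' : Submodule ℚ (bettiCohomology X n)) (hN : N ≠ ⊤) {t : bettiCohomology X n ⊗[ℚ] bettiCohomology X n}
    (hid : corrAction complexOrientationFamily hX hX (rfl : n + 2 * n = n + 2 * n) (ofRatClass (ComplexPoints (X ⊗ X)) (2 * n) (BettiUniverse.crossMap X X (two_mul n).symm t)) = LinearMap.id) :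
    t ∉ LinearMap.range (TensorProduct.mapIncl N N') := by
  intro hmem
  haveI := BettiUniverse.finite hX n
  haveI := finite_complexBetti hX n
  apply hN
  -- every rational class lies in `span_ℂ (N ⊗ 1)`
  have hle : Submodule.span ℂ (ofRatClass (ComplexPoints X) n '' ((⊤ : Submodule ℚ (bettiCohomology X n)) : Set (bettiCohomology X n))) ≤
      Submodule.span ℂ (ofRatClass (ComplexPoints X) n '' (N : Set (bettiCohomology X n))) := by
    refine Submodule.span_le.2 ?_
    rintro _ ⟨v, -, rfl⟩
    have hv := corrAction_ofRatClass_crossMap_mem_span_of_mem_range_mapIncl complexOrientationFamily hasPoincareDuality_complexOrientationFamily hX hX (two_mul n).symm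
      (two_mul n).symm (rfl : n + 2 * n = n + 2 * n) N N' hmem (ofRatClass (ComplexPoints X) n v)
    rw [hid, LinearMap.id_apply] at hv
    exact hv
  have hrank := Submodule.finrank_mono hle
  rw [BettiUniverse.finrank_span_image_ofRatClass, BettiUniverse.finrank_span_image_ofRatClass, finrank_top] at hrank
  exact Submodule.eq_top_of_finrank_eq (le_antisymm (Submodule.finrank_le N) hrank)

/-- In particular (with `HC`-type input only through the Hodge classes): for `X` of even dimension `n = 2h` with `Hdgʰ(HⁿX) ≠ Hⁿ(X;ℚ)`, the middle Künneth component of the diagonal — any Hodge class of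
`Hⁿ(X) ⊗ Hⁿ(X)` with algebraic cross product acting as `Id` on `Hⁿ(X;ℂ)` (g29-#6 §2) — lies OUTSIDE `Hdgʰ(HⁿX) ⊗ Hdgʰ(HⁿX)`. [cite: VoisinHodgeI2002, §11.3.3 p. 287] [cite: Voisin2025, §3.2.1 Prop. 3.8 and Cor. 3.9] -/
theorem BettiUniverse.exists_kunneth_middle_algebraic_not_mem_of_ne_top [HodgeTensorFacts.{0, 0}] (hHD : exists_isReal_hodgeModel) (hX : IsSmoothProjective n X) (hHC : HodgeConjectureFor n X)
    (hodd : ∀ k, Odd k → k ≠ n → Module.finrank ℚ (bettiCohomology X k) = 0) (heven : ∀ p, 2 * p ≠ n → (BettiUniverse.hodge hHD hX (2 * p)).hodgeClasses p = ⊤) {h : ℤ}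
    (hne : (BettiUniverse.hodge hHD hX n).hodgeClasses h ≠ ⊤) :
    ∃ t ∈ (BettiUniverse.kunnethSummand hHD hX hX (2 * n) ⟨(n, n), HasAntidiagonal.mem_antidiagonal.2 (two_mul n).symm⟩).hodgeClasses n,
      ofRatClass (ComplexPoints (X ⊗ X)) (2 * n) (BettiUniverse.crossMap X X (two_mul n).symm t) ∈ algebraicClasses (X ⊗ X) n ∧
      t ∉ LinearMap.range (TensorProduct.mapIncl ((BettiUniverse.hodge hHD hX n).hodgeClasses h) ((BettiUniverse.hodge hHD hX n).hodgeClasses h)) := by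
  obtain ⟨t, ht, halg, hid⟩ := BettiUniverse.exists_kunneth_middle_algebraic_corrAction_eq_id hHD hX hHC hodd heven
  exact ⟨t, ht, halg, BettiUniverse.not_mem_range_mapIncl_of_corrAction_eq_id hX _ _ hne hid⟩

/-! ### §2 `HC(X × X)` in even dimension -/

/-- **`HC(X × X)` for `X` smooth projective of EVEN dimension `n = 2h` with `HC(X)`, no odd cohomology, `Hdgᵖ(H^{2p}X) = H^{2p}(X;ℚ)` for `2p ≠ n`, and `dim_ℚ End_HS(HⁿX) ≤ ρ_h(X)² + 1`**
(`ρ_h = dim_ℚ Hdgʰ(HⁿX)`) — UNCONDITIONALLY in everything else: only the pieces `Hⁱ ⊗ Hʲ`, `1 ≤ i, j ≤ n`, matter (g29-#2); those other than `Hⁿ ⊗ Hⁿ` vanish or have a pure factor (g29-#6 §1); if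
`Hdgʰ(HⁿX) = Hⁿ(X;ℚ)` all even cohomology is pure (g27-#5); otherwise `Hdgʰ ⊗ Hdgʰ ⊕ ℚ·t_{n,n}` (`t_{n,n}` the middle Künneth component of `[Δ_X]`, outside `Hdgʰ ⊗ Hdgʰ` by §1) has dimension
`ρ_h² + 1 ≥ dim Hdgⁿ(Hⁿ ⊗ Hⁿ) = dim End_HS(HⁿX)` (Lemma 11.41), hence IS the space of Hodge classes of the middle piece, and all its cross products are algebraic.  E.g. the general even-dimensional
hypersurface or complete intersection satisfying `HC` (`End_HS` of the transcendental part `= ℚ`). [cite: VoisinHodgeI2002, §11.3.3 Thm. 11.38–11.40, Lemma 11.41 and p. 287]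
[cite: Voisin2025, §3.2.1 (12)–(14), Prop. 3.8 and Cor. 3.9] [cite: VoisinHodgeII2003, §9.2.4 Prop. 9.20] [cite: Deligne2000, §1] -/
theorem BettiUniverse.hodgeConjectureFor_tensor_self_of_offMiddle_algebraic_of_finrank_end_le (hHD : exists_isReal_hodgeModel) (hX : IsSmoothProjective n X) (hXX : IsSmoothProjective d (X ⊗ X))
    (hHC : HodgeConjectureFor n X) {h : ℕ} (hn : n = 2 * h) (hodd : ∀ k, Odd k → Module.finrank ℚ (bettiCohomology X k) = 0)
    (heven : ∀ p, 2 * p ≠ n → (BettiUniverse.hodge hHD hX (2 * p)).hodgeClasses p = ⊤)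
    (hEnd : Module.finrank ℚ (HodgeStructure.Hom (BettiUniverse.hodge hHD hX n) (BettiUniverse.hodge hHD hX n)) ≤ Module.finrank ℚ ↥((BettiUniverse.hodge hHD hX n).hodgeClasses h) ^ 2 + 1) :
    HodgeConjectureFor d (X ⊗ X) := by
  haveI : HodgeTensorFacts.{0, 0} := hodgeTensorFacts_holds
  subst hn
  haveI := BettiUniverse.finite hX (2 * h)
  have halgX : ∀ (p : ℕ), ∀ z ∈ (BettiUniverse.hodge hHD hX (2 * p)).hodgeClasses (p : ℤ), ofRatClass (ComplexPoints X) (2 * p) z ∈ algebraicClasses X p :=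
    fun p z hz ↦ hHC.2 p _ (isRationalClass_ofRatClass _) ((BettiUniverse.mem_hodgeClasses_hodge_iff_isOfHodgeType hHD hX p z).1 hz)
  -- the pure case: `Hdgʰ(HⁿX) = Hⁿ(X;ℚ)`
  by_cases htop : (BettiUniverse.hodge hHD hX (2 * h)).hodgeClasses h = ⊤
  · refine BettiUniverse.hodgeConjectureFor_tensor_of_pure_even_of_odd_vanishing hHD hX hX hXX (fun a ↦ ?_) hodd hHC hHC
    by_cases ha : 2 * a = 2 * h
    · obtain rfl : a = h := by omega
      exact htop
    · exact heven a ha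
  -- the general case: the middle Künneth component of the diagonal
  obtain ⟨t₀, ht₀, halg₀, hnot⟩ := BettiUniverse.exists_kunneth_middle_algebraic_not_mem_of_ne_top hHD hX hHC (fun k hk _ ↦ hodd k hk) heven htop
  refine BettiUniverse.hodgeConjectureFor_tensor_of_kunneth_pieces_pos_le hHD hX hX hXX hHC hHC fun c i j hij hi1 hi hj1 hj hc2 t ht ↦ ?_
  by_cases hmid : i = 2 * h ∧ j = 2 * h
  · -- the middle piece `Hⁿ ⊗ Hⁿ`
    obtain ⟨hin, hjn⟩ := hmid
    subst hin
    subst hjn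
    obtain rfl : c = 2 * h := by omega
    set NS := (BettiUniverse.hodge hHD hX (2 * h)).hodgeClasses (h : ℤ) with hNS
    set P₀ : Submodule ℚ (bettiCohomology X (2 * h) ⊗[ℚ] bettiCohomology X (2 * h)) := LinearMap.range (TensorProduct.mapIncl NS NS) with hP₀
    have hidx : (((2 * h : ℕ)) : ℤ) = (h : ℤ) + h := by push_cast; ring
    have hP₀le : P₀ ≤ ((BettiUniverse.hodge hHD hX (2 * h)).tensor (BettiUniverse.hodge hHD hX (2 * h))).hodgeClasses (((2 * h : ℕ)) : ℤ) := by
      rw [hP₀, TensorProduct.range_mapIncl, Submodule.map₂_le]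
      intro y hy z hz
      have hyz := HodgeStructure.tmul_mem_hodgeClasses_tensor _ _ hy hz
      rw [← hidx] at hyz
      exact hyz
    have ht₀' : t₀ ∈ ((BettiUniverse.hodge hHD hX (2 * h)).tensor (BettiUniverse.hodge hHD hX (2 * h))).hodgeClasses (((2 * h : ℕ)) : ℤ) := ht₀
    have hPle : P₀ ⊔ (ℚ ∙ t₀) ≤ ((BettiUniverse.hodge hHD hX (2 * h)).tensor (BettiUniverse.hodge hHD hX (2 * h))).hodgeClasses (((2 * h : ℕ)) : ℤ) :=
      sup_le hP₀le ((Submodule.span_singleton_le_iff_mem _ _).2 ht₀')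
    haveI : Module.Free ℚ ↥NS := Module.Free.of_divisionRing ℚ _
    have hP₀rank : Module.finrank ℚ ↥P₀ = Module.finrank ℚ ↥NS * Module.finrank ℚ ↥NS := by
      rw [hP₀, LinearMap.finrank_range_of_inj (Module.Flat.tensorProduct_mapIncl_injective_of_right _ _), Module.finrank_tensorProduct]
    have ht₀ne : t₀ ≠ 0 := fun h0 ↦ hnot (h0 ▸ Submodule.zero_mem _)
    have hinf : P₀ ⊓ (ℚ ∙ t₀) = ⊥ := by
      refine eq_bot_iff.2 fun x hx ↦ ?_
      obtain ⟨hx₀, hx₁⟩ := Submodule.mem_inf.1 hx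
      obtain ⟨c, rfl⟩ := Submodule.mem_span_singleton.1 hx₁
      by_cases hc : c = 0
      · rw [hc, zero_smul]
        exact Submodule.zero_mem _
      · exact absurd (by have h' := P₀.smul_mem c⁻¹ hx₀; rwa [smul_smul, inv_mul_cancel₀ hc, one_smul] at h') hnot
    have hPrank : Module.finrank ℚ ↥(P₀ ⊔ (ℚ ∙ t₀)) = Module.finrank ℚ ↥NS * Module.finrank ℚ ↥NS + 1 := by
      have e := Submodule.finrank_sup_add_finrank_inf_eq P₀ (ℚ ∙ t₀)
      rw [hinf, finrank_bot, add_zero, hP₀rank, finrank_span_singleton ht₀ne] at e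
      exact e
    have hHrank : Module.finrank ℚ ↥(((BettiUniverse.hodge hHD hX (2 * h)).tensor (BettiUniverse.hodge hHD hX (2 * h))).hodgeClasses (((2 * h : ℕ)) : ℤ)) =
        Module.finrank ℚ (HodgeStructure.Hom (BettiUniverse.hodge hHD hX (2 * h)) (BettiUniverse.hodge hHD hX (2 * h))) :=
      BettiUniverse.finrank_hodgeClasses_tensor_hodge_eq_finrank_hom hHD hX hX (2 * h)
    have hPeq : P₀ ⊔ (ℚ ∙ t₀) = ((BettiUniverse.hodge hHD hX (2 * h)).tensor (BettiUniverse.hodge hHD hX (2 * h))).hodgeClasses (((2 * h : ℕ)) : ℤ) :=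
      Submodule.eq_of_le_of_finrank_le hPle (by rw [hHrank, hPrank]; nlinarith [hEnd, sq (Module.finrank ℚ ↥NS)])
    have ht' : t ∈ P₀ ⊔ (ℚ ∙ t₀) := by
      rw [hPeq]
      exact ht
    obtain ⟨p, hp, z, hz, rfl⟩ := Submodule.mem_sup.1 ht'
    obtain ⟨q, rfl⟩ := Submodule.mem_span_singleton.1 hz
    rw [map_add, map_add, map_smul, ofRatClass_rat_smul']
    refine Submodule.add_mem _ ?_ (Submodule.smul_mem _ _ halg₀)
    -- `p ∈ Hdgʰ ⊗ Hdgʰ`: exterior products of algebraic classes (`HC(X)`)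
    rw [hP₀] at hp
    obtain ⟨w, rfl⟩ := hp
    clear ht ht' hz
    induction w using TensorProduct.induction_on with
    | zero => rw [map_zero, map_zero, map_zero]; exact Submodule.zero_mem _
    | tmul a b =>
      rw [TensorProduct.mapIncl, TensorProduct.map_tmul, Submodule.subtype_apply, Submodule.subtype_apply]
      exact ofRatClass_crossMap_tmul_mem_algebraicClasses' hX hX hij (halgX h _ a.2) (halgX h _ b.2)
    | add x y hx hy => rw [map_add, map_add, map_add]; exact Submodule.add_mem _ hx hy
  -- the other pieces: zero or with a pure factor
  rcases Nat.even_or_odd i with ⟨a, ha⟩ | hio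
  · obtain ⟨a, rfl⟩ : ∃ a', i = 2 * a' := ⟨a, by omega⟩
    obtain ⟨b, rfl⟩ : ∃ b, j = 2 * b := ⟨j / 2, by omega⟩
    by_cases han : 2 * a = 2 * h
    · have hbn : 2 * b ≠ 2 * h := fun hb ↦ hmid ⟨han, hb⟩
      exact BettiUniverse.ofRatClass_crossMap_mem_algebraicClasses_of_hodgeClasses_eq_top_right hHD hX hX hij (heven b hbn) (halgX a)
        (fun z ↦ halgX b z (by rw [heven b hbn]; exact Submodule.mem_top)) ht
    · exact BettiUniverse.ofRatClass_crossMap_mem_algebraicClasses_of_hodgeClasses_eq_top_left hHD hX hX hij (heven a han)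
        (fun z ↦ halgX a z (by rw [heven a han]; exact Submodule.mem_top)) (halgX b) ht
  · exact BettiUniverse.ofRatClass_crossMap_mem_algebraicClasses_of_finrank_eq_zero hX hX hij (Or.inl (hodd i hio)) t

end Literature.AlgebraicGeometry.HodgeTheory

/-! ### §3 Smooth hypersurfaces of even dimension -/

namespace Literature.AlgebraicGeometry.Motives.IsSmoothHypersurface

open Literature.AlgebraicGeometry.Motives
open Literature.AlgebraicGeometry.HodgeTheory

variable {m e : ℕ} {Y : SchemeOver ℂ}

/-- **`HC(Y × Y)` for a smooth hypersurface `Y ⊂ ℙ^{m+1}_ℂ` of EVEN dimension `m = 2h` with `HC(Y)` and `dim_ℚ End_HS(HᵐY) ≤ ρ_h(Y)² + 1`** (`ρ_h = dim_ℚ Hdgʰ(HᵐY)`; e.g. quadrics and cubic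
fourfolds with `End_HS` of the transcendental part `= ℚ`): a smooth hypersurface has no odd cohomology off the middle degree (none at all for `m` even) and algebraic even cohomology off the middle
degree (Cor. 1.24/1.25, g29-#7), so §2 applies.  The odd-dimensional companion is g29-#7's `hodgeConjectureFor_tensor_self_of_odd_of_finrank_end_le_one`.
[cite: VoisinHodgeII2003, §1.2.3 Cor. 1.24 and Cor. 1.25] [cite: VoisinHodgeI2002, §11.3.3 Lemma 11.41 and p. 287] [cite: Voisin2025, §3.2.1 (12)–(14), Prop. 3.8 and Cor. 3.9] -/
theorem hodgeConjectureFor_tensor_self_of_even_of_finrank_end_le (hY : IsSmoothHypersurface m e Y) (hHD : exists_isReal_hodgeModel) {h : ℕ} (hm : m = 2 * h) (hHC : HodgeConjectureFor m Y)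
    (hEnd : Module.finrank ℚ (HodgeStructure.Hom (BettiUniverse.hodge hHD hY.1 m) (BettiUniverse.hodge hHD hY.1 m)) ≤
      Module.finrank ℚ ↥((BettiUniverse.hodge hHD hY.1 m).hodgeClasses h) ^ 2 + 1) : HodgeConjectureFor (m + m) (Y ⊗ Y) :=
  BettiUniverse.hodgeConjectureFor_tensor_self_of_offMiddle_algebraic_of_finrank_end_le hHD hY.1 (hY.1.tensor_holds hY.1) hHC hm
    (fun _ hk ↦ hY.finrank_bettiCohomology_eq_zero_of_odd hk fun hkm ↦ (Nat.not_even_iff_odd.2 hk) ⟨h, by omega⟩) (fun _ hp ↦ hY.hodgeClasses_hodge_eq_top_of_two_mul_ne hHD hY.1 hp) hEnd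

end Literature.AlgebraicGeometry.Motives.IsSmoothHypersurface

end
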